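import Literature.Topology.FourManifolds.TrisectionsTriNormalForm
import Literature.Topology.FourManifolds.TrisectionSectorCollars
import Literature.Topology.FourManifolds.RegularLevelSplitting
import Literature.Topology.FourManifolds.Gluing
import Literature.Topology.FourManifolds.CollarTheorem

/-!
# `stub_prismRigidity` — the lead's work file (crux stmt-SmoothPoincare4-10894, line lp-by-sphere-system-surgery, r4)

NOT a proof.  This file records, KERNEL-CHECKED AS STATEMENTS, the two general-purpose lemmas
of the revised Step B plan (P1)–(P6) of `Cruxes/AgkCor6Sufficiency/SpineRigidityArchitecture.md`
that are independent of trisections, so that the promoted crux inherits precise targets: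

* (P5) `CoreIndependence` — the core `W ∖ c(∂W × [0,a))` of a compact manifold with boundary is
  independent of the collar `c` and the level `a` up to a diffeomorphism of `W` that is the
  identity off a compact subset of the interior (hence transportable into any ambient manifold in
  which the interior of `W` is openly embedded, by extension by the identity);
* (P3) `ProductLikeNormalisation` — a diffeomorphism of compact manifolds with boundary extending
  a given boundary diffeomorphism can be chosen product-like with respect to given collars near
  the boundary (uniqueness of collars rel boundary; Hirsch 4.6, Munkres §6).

The trisection-specific pieces (P1) smooth structure of `F` from the corner-slice atlas and the
diffeomorphism `Ξ = (u, v, ρ)`, (P2) `G_Ξ`, (P4) seam bicollars + flow conjugation, (P6) assembly,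
are described in the architecture note; their natural home is a `TriNormalForm`-based file family
next to `TrisectionsStabilization*.lean`.
-/

noncomputable section

set_option linter.dupNamespace false

open Set Function
open scoped Manifold ContDiff Topology

namespace Summit.SmoothPoincare4.SmoothPoincare4.Cruxes.AgkCor6Sufficiency.LpBySphereSystemSurgery

open Literature.Topology.FourManifolds

universe u

/-- **(P5) Core independence** (target statement, NOT asserted): for a compact smooth
`(n+2)`-manifold with boundary `W`, a boundary datum `b`, two collars `c, ĉ` of `b` and two levels
`a, â ∈ (0, 1)`, there is a self-diffeomorphism `Φ` of `W`, equal to the identity off a compact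
subset of the interior, carrying the open collar end `c(∂W × [0, a))` onto `ĉ(∂W × [0, â))` —
equivalently the core `W ∖ c(∂W × [0,a))` onto the core `W ∖ ĉ(∂W × [0, â))`.  (Collars are flows
of inward vector fields, which form a convex set; slide along `c` to a thin core, interpolate the
fields, use isotopy extension inside the interior, slide back out along `ĉ`.) -/
def CoreIndependence : Prop :=
  ∀ (n : ℕ) (W : Type u) [TopologicalSpace W] [T2Space W] [SecondCountableTopology W]
    [CompactSpace W] [ChartedSpace (EuclideanHalfSpace (n + 2)) W] [IsManifold (𝓡∂ (n + 2)) ∞ W]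
    (b : BoundaryData (𝓡∂ (n + 2)) W (𝓡 (n + 1))) (c ĉ : b.Collar) (a â : ℝ),
    0 < a → a < 1 → 0 < â → â < 1 →
    ∃ Φ : W ≃ₘ⟮𝓡∂ (n + 2), 𝓡∂ (n + 2)⟯ W,
      (∃ K : Set W, IsCompact K ∧ K ⊆ (𝓡∂ (n + 2)).interior W ∧ ∀ w, w ∉ K → Φ w = w) ∧
      Φ '' (c '' {p | (p.2 : ℝ) < a}) = ĉ '' {p | (p.2 : ℝ) < â}

/-- **(P3) Product-like normalisation of a boundary-extending diffeomorphism** (target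
statement, NOT asserted): given compact smooth `(n+2)`-manifolds with boundary `H, H'`, boundary
data `b, b'` with collars `c, c'`, a boundary diffeomorphism `φ` and an extension `Φ : H ≅ H'` of
it (`Φ ∘ b.incl = b'.incl ∘ φ`), there is another extension `Φ̃` of `φ` which is PRODUCT-LIKE
near the boundary: `Φ̃ (c (x, t)) = c' (φ x, t)` for all `t ≤ ε`, for some `ε > 0`.  (Uniqueness
of collars rel boundary: `Φ ∘ c` and `c' ∘ (φ × id)` are two collars of `b'` with the same
bottom; a diffeotopy of `H'` fixing `∂H'` makes them agree near the bottom.) -/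
def ProductLikeNormalisation : Prop :=
  ∀ (n : ℕ) (H : Type u) [TopologicalSpace H] [T2Space H] [SecondCountableTopology H]
    [CompactSpace H] [ChartedSpace (EuclideanHalfSpace (n + 2)) H] [IsManifold (𝓡∂ (n + 2)) ∞ H]
    (H' : Type u) [TopologicalSpace H'] [T2Space H'] [SecondCountableTopology H']
    [CompactSpace H'] [ChartedSpace (EuclideanHalfSpace (n + 2)) H'] [IsManifold (𝓡∂ (n + 2)) ∞ H']
    (b : BoundaryData (𝓡∂ (n + 2)) H (𝓡 (n + 1))) (b' : BoundaryData (𝓡∂ (n + 2)) H' (𝓡 (n + 1)))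
    (c : b.Collar) (c' : b'.Collar) (φ : b.carrier ≃ₘ⟮𝓡 (n + 1), 𝓡 (n + 1)⟯ b'.carrier)
    (Φ : H ≃ₘ⟮𝓡∂ (n + 2), 𝓡∂ (n + 2)⟯ H'), ⇑Φ ∘ b.incl = b'.incl ∘ ⇑φ →
    ∃ (Φ' : H ≃ₘ⟮𝓡∂ (n + 2), 𝓡∂ (n + 2)⟯ H') (ε : ℝ), 0 < ε ∧ ⇑Φ' ∘ b.incl = b'.incl ∘ ⇑φ ∧
      ∀ (x : b.carrier) (t : Set.Icc (0 : ℝ) 1), (t : ℝ) ≤ ε → Φ' (c (x, t)) = c' (φ x, t)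

end Summit.SmoothPoincare4.SmoothPoincare4.Cruxes.AgkCor6Sufficiency.LpBySphereSystemSurgery

end
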